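import Mathlib
import Summits.PneNP.PneNP.Theorems.ClusUniversalCertificateCoordInv
import Summits.PneNP.PneNP.Theorems.ClusUniversalCertificateCoordBookBlkT

/-!
# Route ClusUniversalCertificate, crux `UniversalCertAll` — path `coord`: FRAME FREEDOM for member certificates

Support file for `stmt-PneNP-19683` (cell pnp-ideate, route `ClusUniversalCertificate`, rung F-N1; path `coord` of pnp-ideate-p1, skeleton
v11 sha16 e5cba65d; objects of record `…CoordDefs.lean` p516754 / `…CoordBlkDefs.lean` p519312, namespace `…Theorems.ClusCoord`).  The glue
named by pnp-ideate-lit g9 (STATUS 10:52Z, memo ROUND-8 §Y) for BEST-FRAME member certificates: the total dimension `dsum` is invariant under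
the affine group (`dsum_image_linearEquiv`, `dsum_image_add`, hence under every affine bijection `x ↦ g x + t`), so in the peel induction a
member `S ⊆ 𝔽₂^{M'}` may be certified by `UCMix M' n' blk' (g S + t)` in ANY frame (`n'`, `blk'`, linear `g`, translate `t` — all covered by
the hypothesis `UCMixDim M'`), giving `dsum M' S ≤ cert_{frame}(S)` (`dsum_le_cert_of_ucMix_frame`); and the block step holds in the
CURRENCY-FREE form (`ucMix_of_member_certs`): if every member satisfies `dsum S ≤ cert S` for some numbers `cert S`, and
`dsum Y ≤ Σ_S dsum S + (|Y|·Σ_j (bsize j − 1) + Σ_j 2^{bsize j} Z_j(Y)) − Σ_S cert S`, then `UCMix M n blk Y` — lit's DSTAR shape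
«certificate of `Y` ≥ Σ (best certificates of the fibres) + LIFT».  Bookkeeping only; the conjecture and the crux are OPEN; FRONTIER rung
F-N1 — nothing here bears on P vs NP.
-/

set_option linter.dupNamespace false -- `Summit.PneNP.PneNP.…`: summit = sub-problem name (D-0017 single-conjunct layout)

namespace Summit.PneNP.PneNP.Theorems.ClusCoordFrame

open Finset
open Summit.PneNP.PneNP.Theorems.ClusCoord (acodim dsum bsize zcount UCMix acodim_image_le)
open Summit.PneNP.PneNP.Theorems.ClusCoordBook (list_sum_map_le)
open Summit.PneNP.PneNP.Theorems.ClusCoordBookBlkT (card_image_add dsum_le_dsum_image_add)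

variable {M n : ℕ}

/-! ## `dsum` is an affine invariant -/

/-- `dsum` does not decrease under a linear automorphism. -/
theorem dsum_le_dsum_image_linearEquiv (Y : Finset (Fin M → ZMod 2)) (g : (Fin M → ZMod 2) ≃ₗ[ZMod 2] (Fin M → ZMod 2)) :
    dsum M Y ≤ dsum M (Y.image fun z => g z) := by
  unfold dsum
  rw [Finset.sum_image fun a _ b _ hab => g.injective hab]
  refine Finset.sum_le_sum fun y hy => ?_
  have := acodim_image_le Y g hy
  have h' : (acodim M (Y.image fun z => g z) (g y) : ℤ) ≤ (acodim M Y y : ℤ) := by exact_mod_cast this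
  linarith

/-- `dsum` is invariant under linear automorphisms. -/
theorem dsum_image_linearEquiv (Y : Finset (Fin M → ZMod 2)) (g : (Fin M → ZMod 2) ≃ₗ[ZMod 2] (Fin M → ZMod 2)) :
    dsum M (Y.image fun z => g z) = dsum M Y := by
  apply le_antisymm _ (dsum_le_dsum_image_linearEquiv Y g)
  have h := dsum_le_dsum_image_linearEquiv (Y.image fun z => g z) g.symm
  have hYY : ((Y.image fun z => g z).image fun z => g.symm z) = Y := by
    rw [Finset.image_image]
    have : ((fun z => g.symm z) ∘ fun z => g z) = id := by
      funext z
      simp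
    rw [this, Finset.image_id]
  rw [hYY] at h
  exact h

/-- `dsum` is invariant under translations. -/
theorem dsum_image_add (Y : Finset (Fin M → ZMod 2)) (t : Fin M → ZMod 2) :
    dsum M (Y.image fun x => x + t) = dsum M Y := by
  apply le_antisymm _ (dsum_le_dsum_image_add Y t)
  have h := dsum_le_dsum_image_add (Y.image fun x => x + t) (-t)
  have hYY : ((Y.image fun x => x + t).image fun x => x + -t) = Y := by
    rw [Finset.image_image]
    have : ((fun x => x + -t) ∘ fun x => x + t) = id := by
      funext x
      simp
    rw [this, Finset.image_id]
  rw [hYY] at h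
  exact h

/-- `dsum` is invariant under affine bijections `x ↦ g x + t`. -/
theorem dsum_image_affine (Y : Finset (Fin M → ZMod 2)) (g : (Fin M → ZMod 2) ≃ₗ[ZMod 2] (Fin M → ZMod 2)) (t : Fin M → ZMod 2) :
    dsum M (Y.image fun x => g x + t) = dsum M Y := by
  have : (Y.image fun x => g x + t) = (Y.image fun z => g z).image fun x => x + t := by
    rw [Finset.image_image]
    rfl
  rw [this, dsum_image_add, dsum_image_linearEquiv]

/-- The cardinality is invariant under affine bijections. -/
theorem card_image_affine (Y : Finset (Fin M → ZMod 2)) (g : (Fin M → ZMod 2) ≃ₗ[ZMod 2] (Fin M → ZMod 2)) (t : Fin M → ZMod 2) :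
    (Y.image fun x => g x + t).card = Y.card :=
  Finset.card_image_of_injective _ fun _ _ hab => g.injective (add_right_cancel hab)

/-! ## Member certificates in any frame, and the currency-free block step -/

/-- **A member may be certified in any frame**: the mixed certificate of the affine image `g S + t` in ANY block structure `blk'` bounds
`dsum S` by that frame's certificate value. -/
theorem dsum_le_cert_of_ucMix_frame {M' n' : ℕ} (blk' : Fin M' → Fin n') (S : Finset (Fin M' → ZMod 2))
    (g : (Fin M' → ZMod 2) ≃ₗ[ZMod 2] (Fin M' → ZMod 2)) (t : Fin M' → ZMod 2)
    (h : UCMix M' n' blk' (S.image fun x => g x + t)) :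
    dsum M' S ≤ (S.card : ℤ) * ∑ j : Fin n', ((bsize blk' j : ℤ) - 1) +
      ∑ j : Fin n', (2 : ℤ) ^ (bsize blk' j) * (zcount blk' j (S.image fun x => g x + t) : ℤ) := by
  unfold UCMix at h
  rw [Finset.sum_sub_distrib, Finset.sum_const, nsmul_eq_mul, card_image_affine] at h
  change dsum M' (S.image fun x => g x + t) - _ ≤ _ at h
  rw [dsum_image_affine] at h
  linarith

/-- **The currency-free block step**: certified upper bounds `cert S` on the members' `dsum` and the inequality
`dsum Y ≤ Σ_S dsum S + cert(Y) − Σ_S cert S` (`cert(Y)` = the mixed certificate value of `Y`) give `UCMix M n blk Y`.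
(Take `cert S` = the best frame certificate of `S` to get lit's DSTAR shape.) -/
theorem ucMix_of_member_certs {M' : ℕ} (blk : Fin M → Fin n) (Y : Finset (Fin M → ZMod 2))
    (L : List (Finset (Fin M' → ZMod 2))) (cert : Finset (Fin M' → ZMod 2) → ℤ) (hcert : ∀ S ∈ L, dsum M' S ≤ cert S)
    (hineq : dsum M Y ≤ (L.map (dsum M')).sum +
      ((Y.card : ℤ) * ∑ j : Fin n, ((bsize blk j : ℤ) - 1) + ∑ j : Fin n, (2 : ℤ) ^ (bsize blk j) * (zcount blk j Y : ℤ)) -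
      (L.map cert).sum) :
    UCMix M n blk Y := by
  have h1 : (L.map (dsum M')).sum ≤ (L.map cert).sum := list_sum_map_le L _ _ hcert
  unfold UCMix
  rw [Finset.sum_sub_distrib, Finset.sum_const, nsmul_eq_mul]
  change dsum M Y - _ ≤ _
  linarith

end Summit.PneNP.PneNP.Theorems.ClusCoordFrame
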